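import Literature.NumberTheory.Transcendental.ThetaFibreCount
import Literature.NumberTheory.Transcendental.ThetaSubgroupDefinable
import Literature.NumberTheory.Transcendental.RatSubspaces
import HarnessLib

/-!
# Classification of the `Θ`-closed irreducible subgroups of `Lie M_κ,ℂ` (any number of elliptic factors, no CM)

Topic: `Literature/NumberTheory/Transcendental`. The last brick of the discharge of the named fact
`Literature.NumberTheory.Transcendental.philippon1986_std`: in a theta model of
`M_κ = 𝔾ₘ^β × P_κ` over a lattice WITHOUT complex multiplication, every closed irreducible additive
subgroup `H ⊆ V = Lie M_κ,ℂ` for the `Θ`-topology (an obstruction subgroup of Roy's zero estimate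
`AnalyticGroupModel.zero_estimate`) is `exp⁻¹(G')` for an explicit connected algebraic subgroup
datum `K = linData H`, with `Lie G' = 𝒯(H)` and `dim G' + 1 ≤ coneDim H`:

* `linData` — `A` = rational relations of the torus directions `yDir 𝒯(H)`, `C = zRel z'(𝒯(H))`,
  `Ξ` = annihilator of the vector directions `sDir 𝒯(H)`; the compatibility `ξκ ∈ span_ℂ C` comes
  from `(0,0,κζ) ∈ 𝒯(H)` (`kappaVec_mem_and_zEmb_mem`, fed by the SATURATION
  `ratHull z'(𝒯(H)) = z'(𝒯(H))` of `ThetaFibreCount` and the base change of `RatSubspaces`);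
* `tangent_linData` — `Lie G' = 𝒯(H)` (splitting `(0, ζ, 0) ∈ 𝒯(H)`, product structure over
  `z' = 0`, rationality of `yDir`);
* `coe_eq_preimageSubgroup_linData` — `H = Lie G' + ker exp` (the closure `Z(𝔍(𝒯(H)))` lies in
  the `Θ`-closed `exp⁻¹(G')` by `ThetaSubgroupDefinable`, is contained in `H`, and has
  `coneDim ≥ dim 𝒯(H) + 1 ≥ coneDim H`, so equals `H` by irreducibility);
* `classification_notCM` — the hypothesis `hCL` of `philippon_of_classification`.

Everything is PROVED; the only definitions are `sAnn` and `linData`.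

## References

* P. Philippon, *Lemmes de zéros dans les groupes algébriques commutatifs*, Bull. Soc. Math.
  France 114 (1986), 355–383, Thm. 2.1. [Philippon1986]
* Yu. V. Nesterenko, P. Philippon (eds.), *Introduction to Algebraic Independence Theory*,
  LNM 1752, Springer 2001, Ch. 11 (D. Roy), Thm. 4.1. [NesterenkoPhilippon2001]
* D. Bertrand, P. Philippon, *Sous-groupes algébriques de groupes algébriques commutatifs*,
  Illinois J. Math. 32 (1988), 263–280. [folklore]
-/

noncomputable section

open Complex MvPolynomial Module
open scoped PeriodPair

namespace Literature.NumberTheory.Transcendental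

namespace GaGmE

namespace Std

variable {β γ δ : Type} [Fintype β] [Fintype γ] [Fintype δ] [DecidableEq γ]
variable (L : PeriodPair) (κM : δ → γ → Kbar)

/-! ### Rational vectors of a saturated subspace -/

omit [DecidableEq γ] in
/-- **A subspace cut out by its rational relations is spanned by its integer vectors.** [folklore] -/
theorem le_span_intVec_of_ratHull_eq {𝔷 : Submodule ℂ (γ → ℂ)} (h𝔷 : Kron.ratHull 𝔷 = 𝔷) :
    𝔷 ≤ Submodule.span ℂ (intVec '' {v : γ → ℤ | intVec v ∈ 𝔷}) := by
  intro z hz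
  have hz' : z ∈ Kron.ratHull 𝔷 := Kron.le_ratHull 𝔷 hz
  rw [Kron.mem_ratHull_iff] at hz'
  have hspan := Rat.mem_span_ratVec_of_forall_sum_eq_zero (Kron.zRel 𝔷 : Set (γ → ℚ)) hz'
  refine (Submodule.span_le.mpr ?_) hspan
  rintro _ ⟨v, hv, rfl⟩
  -- `ratVec v ∈ 𝔷` and it is a rational multiple of an integer vector of `𝔷`
  have hvmem : Rat.ratVec v ∈ 𝔷 := by
    rw [← h𝔷, Kron.mem_ratHull_iff]
    intro c hc
    have := hv c hc
    have h' : ((∑ b, c b * v b : ℚ) : ℂ) = 0 := by rw [this]; simp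
    push_cast at h'
    simpa [Rat.ratVec] using h'
  obtain ⟨d, w, hd, hw⟩ := exists_int_multiple v
  have hwv : intVec w = (d : ℂ) • Rat.ratVec v := by
    funext b
    simp only [intVec, Pi.smul_apply, smul_eq_mul, Rat.ratVec_apply]
    have := hw b
    have h' : ((w b : ℚ) : ℂ) = ((d * v b : ℚ) : ℂ) := by rw [this]
    push_cast at h'
    exact h'
  have hwmem : intVec w ∈ 𝔷 := by rw [hwv]; exact Submodule.smul_mem _ _ hvmem
  have hdC : (d : ℂ) ≠ 0 := by exact_mod_cast hd
  have : Rat.ratVec v = (d : ℂ)⁻¹ • intVec w := by rw [hwv, smul_smul, inv_mul_cancel₀ hdC, one_smul]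
  rw [SetLike.mem_coe, this]
  exact Submodule.smul_mem _ _ (Submodule.subset_span ⟨w, hwmem, rfl⟩)

/-- The annihilator of a subspace of the vector directions. [folklore] -/
def sAnn (S : Submodule ℂ (δ → ℂ)) : Submodule ℂ (δ → ℂ) where
  carrier := {ξ | ∀ σ ∈ S, ∑ e, ξ e * σ e = 0}
  zero_mem' := fun σ _ => by simp
  add_mem' := by
    intro ξ ξ' hξ hξ' σ hσ
    simp only [Pi.add_apply, add_mul, Finset.sum_add_distrib, hξ σ hσ, hξ' σ hσ, add_zero]
  smul_mem' := by
    intro c ξ hξ σ hσ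
    simp only [Pi.smul_apply, smul_eq_mul, mul_assoc, ← Finset.mul_sum, hξ σ hσ, mul_zero]

omit [Fintype β] [Fintype γ] [DecidableEq γ] in
/-- Membership in `sAnn`. [folklore] -/
theorem mem_sAnn_iff {S : Submodule ℂ (δ → ℂ)} {ξ : δ → ℂ} : ξ ∈ sAnn S ↔ ∀ σ ∈ S, ∑ e, ξ e * σ e = 0 := Iff.rfl

omit [Fintype β] [Fintype γ] [Fintype δ] [DecidableEq γ] in
/-- The torus part of `coords y z s`. [folklore] -/
@[simp] theorem yPart_coords_eq (y : β → ℂ) (z : γ → ℂ) (s : δ → ℂ) : yPart (coords y z s) = y := by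
  funext j; simp [yPart]

omit [Fintype β] [Fintype γ] [Fintype δ] [DecidableEq γ] in
/-- The vector part of `coords y z s`. [folklore] -/
@[simp] theorem sPart_coords_eq (y : β → ℂ) (z : γ → ℂ) (s : δ → ℂ) : sPart (coords y z s) = s := by
  funext e'; simp [sPart]

/-! ### The datum of a closed irreducible subgroup -/

section Model

variable {N : ℕ} (M : AnalyticGroupModel (β ⊕ (γ ⊕ δ) → ℂ) N) (e : Option β × ThetaIdx γ δ ≃ Fin (N + 1))
variable (hΘ : ∀ J w, M.Θ (e J) w = theta L κM J w)
include hΘ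

/-- **Compatibility and splitting for a closed irreducible subgroup** (no CM): for every `ζ` in
the abelian projection of `𝒯(H)`, `(0,0,κζ) ∈ 𝒯(H)` and `(0,ζ,0) ∈ 𝒯(H)`. [folklore] -/
theorem kappaVec_mem_and_zEmb_mem_of_isIrred (hCM : ¬ L.HasCM) {H : AddSubgroup (β ⊕ (γ ⊕ δ) → ℂ)}
    (hH : M.IsIrred (H : Set (β ⊕ (γ ⊕ δ) → ℂ))) {ζ : γ → ℂ}
    (hζ : ζ ∈ (AnalyticGroupModel.linSpace (H : Set (β ⊕ (γ ⊕ δ) → ℂ))).map zProj) :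
    coords (0 : β → ℂ) (0 : γ → ℂ) (kappaVec κM ζ) ∈ AnalyticGroupModel.linSpace (H : Set (β ⊕ (γ ⊕ δ) → ℂ)) ∧
      coords (0 : β → ℂ) ζ (0 : δ → ℂ) ∈ AnalyticGroupModel.linSpace (H : Set (β ⊕ (γ ⊕ δ) → ℂ)) :=
  kappaVec_mem_and_zEmb_mem L κM M e hΘ hH.isClosedG {v : γ → ℤ | intVec v ∈
      (AnalyticGroupModel.linSpace (H : Set (β ⊕ (γ ⊕ δ) → ℂ))).map zProj} (fun _ hv => hv)
    (le_span_intVec_of_ratHull_eq (ratHull_zProj_linSpace_eq L κM M e hΘ hCM hH)) hζ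

end Model

/-- **The algebraic subgroup datum of a closed irreducible subgroup `H`** (no CM):
`A = yRelQ (yDir 𝒯(H))`, `C = zRel z'(𝒯(H))`, `Ξ = sAnn (sDir 𝒯(H))`. [folklore] -/
def linData {N : ℕ} (M : AnalyticGroupModel (β ⊕ (γ ⊕ δ) → ℂ) N) (e : Option β × ThetaIdx γ δ ≃ Fin (N + 1))
    (hΘ : ∀ J w, M.Θ (e J) w = theta L κM J w) (hCM : ¬ L.HasCM) {H : AddSubgroup (β ⊕ (γ ⊕ δ) → ℂ)}
    (hH : M.IsIrred (H : Set (β ⊕ (γ ⊕ δ) → ℂ))) : SubgroupDataC β γ δ κM where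
  A := yRelQ (yDir (AnalyticGroupModel.linSpace (H : Set (β ⊕ (γ ⊕ δ) → ℂ))))
  C := Kron.zRel ((AnalyticGroupModel.linSpace (H : Set (β ⊕ (γ ⊕ δ) → ℂ))).map zProj)
  Ξ := sAnn (sDir (AnalyticGroupModel.linSpace (H : Set (β ⊕ (γ ⊕ δ) → ℂ))))
  compat ξ hξ := by
    classical
    set 𝔥 := AnalyticGroupModel.linSpace (H : Set (β ⊕ (γ ⊕ δ) → ℂ)) with h𝔥
    set 𝔷₀ := 𝔥.map zProj with h𝔷₀
    set r : γ → ℂ := fun b => ∑ e', ξ e' * (κM e' b : ℂ) with hr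
    -- `r` kills `𝔷₀`
    have hr0 : ∀ ζ ∈ 𝔷₀, ∑ b, r b * ζ b = 0 := by
      intro ζ hζ
      have hκ : kappaVec κM ζ ∈ sDir 𝔥 := (kappaVec_mem_and_zEmb_mem_of_isIrred L κM M e hΘ hCM hH hζ).1
      have := (mem_sAnn_iff.mp hξ) _ hκ
      rw [← this]
      simp only [hr, kappaVec, Finset.sum_mul, Finset.mul_sum]
      rw [Finset.sum_comm]
      exact Finset.sum_congr rfl fun e' _ => Finset.sum_congr rfl fun b _ => by ring
    -- base change
    have hsat := ratHull_zProj_linSpace_eq L κM M e hΘ hCM hH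
    set S : Set (γ → ℚ) := {v | Rat.ratVec v ∈ 𝔷₀} with hS
    have h1 := Rat.mem_span_ratVec_of_forall_sum_eq_zero S (x := r) fun v hv => by
      rw [← hr0 _ hv]
      exact Finset.sum_congr rfl fun b _ => by rw [Rat.ratVec_apply, mul_comm]
    refine (Submodule.span_mono ?_) h1
    rintro _ ⟨c, hc, rfl⟩
    refine ⟨c, ?_, rfl⟩
    -- `c` kills all rational vectors of `𝔷₀`, hence `𝔷₀`
    show c ∈ Kron.zRel 𝔷₀
    rw [Kron.mem_zRel_iff]
    intro z hz
    have hzspan := le_span_intVec_of_ratHull_eq hsat hz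
    -- the functional `z ↦ ∑ c_b z_b`
    let φ : (γ → ℂ) →ₗ[ℂ] ℂ :=
      { toFun := fun z => ∑ b, (c b : ℂ) * z b
        map_add' := fun z z' => by simp [mul_add, Finset.sum_add_distrib]
        map_smul' := fun a z => by simp [Finset.mul_sum, mul_left_comm] }
    have hφ : Submodule.span ℂ (intVec '' {v : γ → ℤ | intVec v ∈ 𝔷₀}) ≤ LinearMap.ker φ := by
      refine Submodule.span_le.mpr ?_
      rintro _ ⟨v, hv, rfl⟩
      rw [SetLike.mem_coe, LinearMap.mem_ker]
      show ∑ b, (c b : ℂ) * intVec v b = 0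
      have hvS : (fun b => (v b : ℚ)) ∈ S := by
        show Rat.ratVec (fun b => (v b : ℚ)) ∈ 𝔷₀
        have : Rat.ratVec (fun b => (v b : ℚ)) = intVec v := by funext b; simp [intVec]
        rw [this]; exact hv
      have := hc _ hvS
      have h' : ((∑ b, (v b : ℚ) * c b : ℚ) : ℂ) = 0 := by rw [this]; simp
      push_cast at h'
      rw [← h']
      exact Finset.sum_congr rfl fun b _ => by simp [intVec]; ring
    have := hφ hzspan
    rw [LinearMap.mem_ker] at this
    exact this

section Model₂

variable {N : ℕ} (M : AnalyticGroupModel (β ⊕ (γ ⊕ δ) → ℂ) N) (e : Option β × ThetaIdx γ δ ≃ Fin (N + 1))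
variable (hΘ : ∀ J w, M.Θ (e J) w = theta L κM J w)
include hΘ

/-- **`Lie G' = 𝒯(H)`** for `K = linData H`. [folklore] -/
theorem tangent_linData (hCM : ¬ L.HasCM) {H : AddSubgroup (β ⊕ (γ ⊕ δ) → ℂ)}
    (hH : M.IsIrred (H : Set (β ⊕ (γ ⊕ δ) → ℂ))) :
    (linData L κM M e hΘ hCM hH).tangent = AnalyticGroupModel.linSpace (H : Set (β ⊕ (γ ⊕ δ) → ℂ)) := by
  classical
  have hcl := hH.isClosedG
  have hsat := ratHull_zProj_linSpace_eq L κM M e hΘ hCM hH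
  have hdec : ∀ w : β ⊕ (γ ⊕ δ) → ℂ, w = coords (yPart w) (0 : γ → ℂ) (sPart w) + coords (0 : β → ℂ) (zPart w) (0 : δ → ℂ) := by
    intro w
    conv_lhs => rw [← coords_yPart_zPart_sPart w]
    rw [← coords_add]
    simp
  ext w
  rw [SubgroupDataC.mem_tangent_iff]
  constructor
  · rintro ⟨hA, hC, hΞ⟩
    have hz : zPart w ∈ (AnalyticGroupModel.linSpace (H : Set (β ⊕ (γ ⊕ δ) → ℂ))).map zProj := by
      have : zPart w ∈ Kron.ratHull ((AnalyticGroupModel.linSpace (H : Set (β ⊕ (γ ⊕ δ) → ℂ))).map zProj) := by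
        rw [Kron.mem_ratHull_iff]
        exact fun c hc => hC c hc
      rwa [hsat] at this
    have hy : yPart w ∈ yDir (AnalyticGroupModel.linSpace (H : Set (β ⊕ (γ ⊕ δ) → ℂ))) :=
      (mem_yDir_iff_forall_yRelQ L κM M e hΘ hcl (yPart w)).mpr fun q hq => hA q hq
    have hs : sPart w ∈ sDir (AnalyticGroupModel.linSpace (H : Set (β ⊕ (γ ⊕ δ) → ℂ))) :=
      mem_of_forall_dotPerp fun ξ hξ => hΞ ξ hξ
    have h1 : coords (yPart w) (0 : γ → ℂ) (sPart w) ∈ AnalyticGroupModel.linSpace (H : Set (β ⊕ (γ ⊕ δ) → ℂ)) :=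
      (mem_linSpace_iff_of_z_eq_zero L κM M e hΘ hcl (r := coords (yPart w) (0 : γ → ℂ) (sPart w)) (fun b => by simp)).mpr
        ⟨by rw [yPart_coords_eq]; exact hy, by rw [sPart_coords_eq]; exact hs⟩
    have h2 := (kappaVec_mem_and_zEmb_mem_of_isIrred L κM M e hΘ hCM hH hz).2
    rw [hdec w]
    exact Submodule.add_mem _ h1 h2
  · intro hw
    have hz : zPart w ∈ (AnalyticGroupModel.linSpace (H : Set (β ⊕ (γ ⊕ δ) → ℂ))).map zProj :=
      Submodule.mem_map_of_mem hw
    have h2 := (kappaVec_mem_and_zEmb_mem_of_isIrred L κM M e hΘ hCM hH hz).2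
    have h1 : coords (yPart w) (0 : γ → ℂ) (sPart w) ∈ AnalyticGroupModel.linSpace (H : Set (β ⊕ (γ ⊕ δ) → ℂ)) := by
      have : coords (yPart w) (0 : γ → ℂ) (sPart w) = w - coords (0 : β → ℂ) (zPart w) (0 : δ → ℂ) := by
        rw [eq_sub_iff_add_eq]; exact (hdec w).symm
      rw [this]; exact Submodule.sub_mem _ hw h2
    have hys := (mem_linSpace_iff_of_z_eq_zero L κM M e hΘ hcl (r := coords (yPart w) (0 : γ → ℂ) (sPart w))
      (fun b => by simp)).mp h1
    rw [yPart_coords_eq, sPart_coords_eq] at hys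
    refine ⟨fun q hq => ?_, fun c hc => ?_, fun ξ hξ => ?_⟩
    · exact ((mem_yDir_iff_forall_yRelQ L κM M e hΘ hcl (yPart w)).mp hys.1) q hq
    · have : zPart w ∈ Kron.ratHull ((AnalyticGroupModel.linSpace (H : Set (β ⊕ (γ ⊕ δ) → ℂ))).map zProj) :=
        Kron.le_ratHull _ hz
      exact (Kron.mem_ratHull_iff.mp this) c hc
    · exact (mem_sAnn_iff.mp hξ) _ hys.2

/-- **`H = Lie G' + ker exp`** for `K = linData H`: the classification of the closed irreducible
subgroups of `Lie M_κ,ℂ` for the `Θ`-topology, any number of elliptic factors, no complex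
multiplication. [cite: NesterenkoPhilippon2001, Ch. 11 Thm. 4.1 (H₀ = T_e⁻¹(H))] -/
theorem coe_eq_preimageSubgroup_linData (hCM : ¬ L.HasCM) {H : AddSubgroup (β ⊕ (γ ⊕ δ) → ℂ)}
    (hH : M.IsIrred (H : Set (β ⊕ (γ ⊕ δ) → ℂ))) :
    (H : Set (β ⊕ (γ ⊕ δ) → ℂ)) = preimageSubgroup L κM (linData L κM M e hΘ hCM hH) ∧
      finrank ℂ (linData L κM M e hΘ hCM hH).tangent + 1 ≤ M.coneDim (H : Set (β ⊕ (γ ⊕ δ) → ℂ)) := by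
  set K := linData L κM M e hΘ hCM hH with hK
  set 𝔥 := AnalyticGroupModel.linSpace (H : Set (β ⊕ (γ ⊕ δ) → ℂ)) with h𝔥
  have hcl := hH.isClosedG
  have hT : K.tangent = 𝔥 := tangent_linData L κM M e hΘ hCM hH
  -- the closure of the lineality space
  set Y := M.zeroSet ((M.vanishing (K.tangent : Set (β ⊕ (γ ⊕ δ) → ℂ)) : Ideal _) :
    Set (MvPolynomial (Fin (N + 1)) ℂ)) with hY
  have hYcl : M.IsClosedG Y := M.isClosedG_zeroSet _
  have h0Y : (0 : β ⊕ (γ ⊕ δ) → ℂ) ∈ Y := M.subset_zeroSet_vanishing _ K.tangent.zero_mem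
  have hYH : Y ⊆ H := by
    rw [← hcl.eq, hY, hT]
    exact M.zeroSet_antitone (M.vanishing_antitone (AnalyticGroupModel.linSpace_subset H))
  have hdimY : finrank ℂ K.tangent + 1 ≤ M.coneDim Y := by
    rw [hY, M.coneDim_zeroSet_vanishing]
    exact finrank_tangent_succ_le_coneDim L κM M e hΘ K
  have hdimH : M.coneDim (H : Set (β ⊕ (γ ⊕ δ) → ℂ)) ≤ finrank ℂ K.tangent + 1 := by
    rw [hT]; exact M.coneDim_le_finrank_linSpace_succ H hH
  have hYeq : Y = H := hH.eq_of_subset_of_coneDim_eq M hYcl ⟨0, h0Y⟩ hYH (hdimH.trans hdimY)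
  refine ⟨Set.Subset.antisymm ?_ ?_, ?_⟩
  · rw [← hYeq]
    exact zeroSet_vanishing_tangent_subset_preimageSubgroup L κM M e hΘ K
  · intro w hw
    have hle : preimageSubgroup L κM K ≤ H := by
      refine sup_le ?_ ((AddSubgroup.closure_le _).mpr (ker_subset_of_isClosedG L κM M e hΘ hcl))
      intro x hx
      have hx' : x ∈ 𝔥 := by rw [← hT]; exact hx
      exact AnalyticGroupModel.linSpace_subset H hx'
    exact hle hw
  · exact hdimY.trans (M.coneDim_mono hYH)

/-- **Classification of the `Θ`-closed irreducible subgroups, no CM** — the hypothesis `hCL` of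
`philippon_of_classification` for a general theta model. [cite: NesterenkoPhilippon2001, Ch. 11 Thm. 4.1] -/
theorem classification_notCM (hCM : ¬ L.HasCM) (H₀ : AddSubgroup (β ⊕ (γ ⊕ δ) → ℂ))
    (hH₀ : M.IsIrred (H₀ : Set (β ⊕ (γ ⊕ δ) → ℂ))) :
    ∃ K : SubgroupDataC β γ δ κM, (preimageSubgroup L κM K : Set (β ⊕ (γ ⊕ δ) → ℂ)) = H₀ ∧
      AnalyticGroupModel.linSpace (↑H₀ : Set (β ⊕ (γ ⊕ δ) → ℂ)) = K.tangent ∧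
      finrank ℂ K.tangent + 1 ≤ M.coneDim (↑H₀ : Set (β ⊕ (γ ⊕ δ) → ℂ)) := by
  obtain ⟨h1, h2⟩ := coe_eq_preimageSubgroup_linData L κM M e hΘ hCM hH₀
  exact ⟨linData L κM M e hΘ hCM hH₀, h1.symm, (tangent_linData L κM M e hΘ hCM hH₀).symm, h2⟩

end Model₂

end Std

end GaGmE

end Literature.NumberTheory.Transcendental

end
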